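import Mathlib
import HarnessLib
import Summits.HubbardSuperconductivity.HubbardSuperconductivity.Theorems.KLProgrammeKLRegimeVolumeLimitFlowFramesV17F2
import Summits.HubbardSuperconductivity.HubbardSuperconductivity.Theses.KLProgramme

/-!
# Rev-22 VL child `KLRegimeVolumeLimitV17F2` (stmt-HubbardSuperconductivity-20440): by-`--workitem` closer from the framed-flow export in POSITION SPACE
# (seat hubbard-kl-k3c5-p3 g7, VL co-registrant; registered skeleton «cauchy v8-F2» 1029f7bae705461f by k3c4-p1 g7)

Thin sequel of …VolumeLimitFlowFramesV17F2 §3 (`volumeLimitTextV17F2_of_framedFlowSiteText`): the two-volume pass read out in position space (pinned site-kernel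
closeness against the periodised site kernel of the nested volume, each volume at its own flow frame) closes the item.  Everything is proved; no definition.
-/

noncomputable section

namespace Summit.HubbardSuperconductivity.HubbardSuperconductivity.Theorems.TwoPointAssembly

set_option linter.dupNamespace false -- summit = problem name (single-conjunct summit), D-0017

open Finset Filter Topology Literature.MathematicalPhysics.QuantumLattice Literature.Probability.LatticeModels
open Literature.MathematicalPhysics.QuantumLattice.FermiRG
open Summit.HubbardSuperconductivity.HubbardSuperconductivity.Theorems.DispersionFlow
open Summit.HubbardSuperconductivity.HubbardSuperconductivity.Theorems.KLRegimeSplit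
open Summit.HubbardSuperconductivity.HubbardSuperconductivity.Theorems.KLProgrammeLegKernels

/-- **The rev-22 VL child `KLRegimeVolumeLimitV17F2` (stmt-…-20440) from the framed-flow export in position space** (by-`--workitem` closer). -/
theorem KLRegimeVolumeLimitV17F2_of_framedFlowSiteText
    (hS : ∀ (G : GeoConsts) (P : SplitConsts) (Q : EngConsts) (R : RenConsts), G.WF → P.WF → Q.WF → R.WF →
      ∃ c₅ : ℝ, 0 < c₅ ∧ ∀ c : ℝ, 0 < c → c ≤ c₅ → ∃ U₀ : ℝ, 0 < U₀ ∧
        ∀ μ ∈ klWindowC, ∀ U : ℝ, 0 < U → U ≤ U₀ → ∀ β : ℝ, klBetaMin ≤ β → β ≤ Real.exp (c / U ^ 2) →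
          ∀ K : TrigPolyC4v, klPredsV17F2.frameOK R U (nScales β) μ K →
            ∀ (Lstar : ℕ) (Mstar : ℕ → ℕ), TowerP klPredsV17F2 G P Q R β U μ K Lstar Mstar →
              ∀ n : ℤ, ∃ L₀ : ℕ, ∃ ρ : ℕ → ℝ, Tendsto ρ atTop (𝓝 0) ∧
                ∀ (L : ℕ) [NeZero L], L₀ ≤ L → ∀ (L'' : ℕ) [NeZero L''] (b : ℕ), L'' = b * L → ∃ M₀ : ℕ, ∀ (M : ℕ) [NeZero M], M₀ ≤ M →
                  ∀ ω : MatsubaraIdx M, matsubaraInt M ω = n →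
                    ∑ y : TorusSite 2 L,
                      ‖torusFourierInv (fun k : TorusSite 2 L =>
                          klSelfEnergy L M β U μ (klFlowFrameU L M β U μ (nScales β + 1)) klE0 (nScales β + 1) (ω, k) 0) y -
                        ∑ x ∈ Finset.univ.filter (fun x : TorusSite 2 L'' => (fun i => (((x i).val : ℕ) : ZMod L)) = y),
                          torusFourierInv (fun k : TorusSite 2 L'' =>
                            klSelfEnergy L'' M β U μ (klFlowFrameU L'' M β U μ (nScales β + 1)) klE0 (nScales β + 1) (ω, k) 0) x‖ ≤ ρ L) :
    Summit.HubbardSuperconductivity.HubbardSuperconductivity.Theses.KLProgramme.KLRegimeVolumeLimitV17F2 := by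
  show VolumeLimitP2 klPredsV17F2 FinalTwoLegVolLimitEx klWindowC
  exact volumeLimitTextV17F2_of_framedFlowSiteText hS

end Summit.HubbardSuperconductivity.HubbardSuperconductivity.Theorems.TwoPointAssembly

end
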